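import Summits.QuantumFields.YangMills.Theorems.UnitScaleTiltProp7HolRatioPerStep
import Literature.MathematicalPhysics.QuantumFieldTheory.Balaban1983to89.BlockAveraging
import Literature.MathematicalPhysics.QuantumFieldTheory.Balaban1983to89.B10StarCount
import HarnessLib

/-!
# Route `UnitScaleTilt`, crux K1 child «MinimiserStabilityRegPr» (stmt-QuantumFields-19200), line «route-R», growth side — THE REVERSAL LAW OF THE LETTER FAMILY:
# THE WALK OF `wordRev w` FROM THE END OF `w` IS THE FLIPPED REVERSE OF THE WALK OF `w`, AND ITS LETTERS ARE `rev(−Ad_{U₀(Γ)⁻¹}Λ(Γ))`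
# (so ✓ `commSum_rev_neg` ∕ ✓ `commSum_threePiece` read the backward legs `(−Γ′)`, `(−c)` of the (0.4) loop word literally)

Cell `ym3-torus`, twin width seat `ym-routeR-w1` (g3); row (w1-o1′) NAMED by the route-R lead `ym-ust-19200-p1` (g13, 13:33:15Z∕13:37:23Z); sequel of
`…Prop7WordLetters` (letters `Λ_t(Z) := ↑(holAt U₀ (Γ.take t)) · ((Γ[t]?).map Z).getD 0 · (↑…)^*`, sum = `covWalkSum`, holonomy ratio = ordered product, concatenation =
`Fin.append`).  THEOREMS ONLY (0 `def`, 0 `sorry`); `--supports stmt-QuantumFields-19200 --as helper`, count-neutral.  YM₃ on T³ is a ladder rung (R3), not the Clay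
problem; nothing here claims stub S, row E′, the crux or the gap.

WHY.  The (0.4) loop word is `Γ ⧺ [x,x′] ⧺ wordRev Γ′ ⧺ wordRev c` (✓ `BlockAveraging.loopWord`); the three-piece split ✓ `Prop7WordCommutatorSplit.commSum_threePiece` reads a
backward block as `fun i ↦ −F′(Fin.rev i)`.  On the lattice: the walk spelled by `wordRev w` from `walkEnd x w` is the step list of `walk x w` REVERSED with every step
FLIPPED (`⟨b, fwd⟩ ↦ ⟨b, ¬fwd⟩`); a flipped step has the starred step factor and the first-order step term `covStep(flip s) = −Ad_{g_s⁻¹}covStep(s)`; hence the `t`-th letter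
of the reversed walk is MINUS the `(T−1−t)`-th letter of the original, conjugated by the inverse total holonomy `U₀(Γ)⁻¹` (a fixed `SU(N)` conjugation, pulled out of the
commutator sum by ✓ `Prop7WordLetters.commSum_conj`).

WHAT IS PROVED (ns `…Theorems.Prop7WordLettersRev`; flip written inline as `⟨s.bond, !s.fwd⟩`).
* §1 ★ `walk_walkEnd_wordRev` — `walk (walkEnd x w) (wordRev w) = ((walk x w).map flip).reverse`; `stepFactor_flip` (`= star`), ★ `covStep_flip`
  (`covStep U₀ Y (flip s) = −(g_s^* · covStep U₀ Y s · g_s)`), `holAt_map_flip_reverse` (`U((Γ.map flip).reverse) = U(Γ)⁻¹`).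
* §2 ★★ `letter_reverse_flip` — for `t < |Γ|`, `Λ_t((Γ.map flip).reverse; covStep) = −(U₀(Γ)^* · Λ_{|Γ|−(t+1)}(Γ; covStep) · U₀(Γ))`;
  ★★ `letter_reverse_flip_eq_rev_neg` — the `Fin |Γ|`-family form `(fun i ↦ Λ_{↑i}(reversed)) = fun i ↦ −(Ad_{U₀(Γ)⁻¹}Λ_{↑(Fin.rev i)}(Γ))`, the input shape of
  ✓ `Prop7OrderedProductExpansion.commSum_rev_neg`.
HONEST SCOPE.  List bookkeeping (`take ∕ drop ∕ reverse ∕ getElem?`) and unitary algebra; no estimate.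

References: T. Bałaban, CMP 109 (1987) 249–301 [Balaban1987RG1] ((0.3)–(0.4) pp.252–253); CMP 98 (1985) 17–51 [Balaban1985Averaging] ((56)–(58) p.27).
-/

noncomputable section

open scoped BigOperators Matrix.Norms.L2Operator

namespace Summit.QuantumFields.YangMills.Theorems.Prop7WordLettersRev

open Literature.MathematicalPhysics.QuantumFieldTheory.Balaban1983to89
open Finset T4Continuum BlockAveraging BlockAveragingEMLLinearised BlockAveragingEMLLinearisedBackground
open Summit.QuantumFields.YangMills.Theorems.Prop7HolRatioPerStep (norm_coe_eq_one norm_star_coe_eq_one coe_star_mul_self coe_mul_star_self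
  stepFactor_mul_star' star_mul_stepFactor')
open B10StarCount (shift_unshift)

variable {P : Params} {n : Type*} [Fintype n] [DecidableEq n] [Nonempty n] {j : ℕ}

/-! ## §1 Reversed words walk the flipped reversed steps -/

omit [Fintype n] [DecidableEq n] [Nonempty n] in
/-- ★ **`walk (walkEnd x w) (wordRev w) = ((walk x w).map flip).reverse`** — the reverse word, walked from the end, traverses the same bonds backwards in reverse order.
[cite: Balaban1987RG1, (0.4) p.253] -/
theorem walk_walkEnd_wordRev : ∀ (x : Site P j) (w : List (Letter P.d)),
    walk (walkEnd x w) (wordRev w) = ((walk x w).map fun s : LStep P j => (⟨s.bond, !s.fwd⟩ : LStep P j)).reverse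
  | x, [] => by simp [walk, walkEnd]
  | x, (μ, true) :: w => by
    rw [wordRev_cons]
    simp only [walkEnd, walk, List.map_cons, List.reverse_cons]
    rw [walk_append, walk_walkEnd_wordRev (x.shift μ) w, walkEnd_walkEnd_wordRev]
    simp [walk, Letter.flip]
  | x, (μ, false) :: w => by
    rw [wordRev_cons]
    simp only [walkEnd, walk, List.map_cons, List.reverse_cons]
    rw [walk_append, walk_walkEnd_wordRev (x.unshift μ) w, walkEnd_walkEnd_wordRev]
    simp [walk, Letter.flip]

omit [Nonempty n] in
/-- The step factor of the flipped step is the star: `g_{flip s} = g_s^*`. [folklore] -/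
theorem stepFactor_flip (U₀ : GaugeField P j (Matrix.specialUnitaryGroup n ℂ)) (s : LStep P j) :
    stepFactor U₀ ⟨s.bond, !s.fwd⟩ = star (stepFactor U₀ s) := by
  unfold stepFactor
  cases s.fwd <;> simp

omit [Nonempty n] in
/-- ★ **`covStep U₀ Y (flip s) = −(g_s^* · covStep U₀ Y s · g_s)`** — the first-order step term of a flipped step is minus the original, transported across the bond.
[cite: Balaban1985Averaging, (56)-(58) p.27] -/
theorem covStep_flip (U₀ : GaugeField P j (Matrix.specialUnitaryGroup n ℂ)) (Y : PBond P j → Matrix n n ℂ) (s : LStep P j) :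
    covStep U₀ Y ⟨s.bond, !s.fwd⟩ = -(star (stepFactor U₀ s) * covStep U₀ Y s * stepFactor U₀ s) := by
  have h1 := coe_mul_star_self (U₀ s.bond)
  unfold covStep stepFactor
  cases s.fwd
  · simp only [Bool.not_false, ↓reduceIte, Bool.false_eq_true, star_star, mul_neg, neg_mul, neg_neg]
    calc Y s.bond = (((U₀ s.bond : Matrix.specialUnitaryGroup n ℂ) : Matrix n n ℂ) * star ((U₀ s.bond : Matrix.specialUnitaryGroup n ℂ) : Matrix n n ℂ))
          * Y s.bond * (((U₀ s.bond : Matrix.specialUnitaryGroup n ℂ) : Matrix n n ℂ) * star ((U₀ s.bond : Matrix.specialUnitaryGroup n ℂ) : Matrix n n ℂ)) := by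
            rw [h1, one_mul, mul_one]
      _ = _ := by noncomm_ring
  · simp only [Bool.not_true, Bool.false_eq_true, ↓reduceIte, star_star]

omit [Fintype n] [DecidableEq n] [Nonempty n] in
/-- **`U((Γ.map flip).reverse) = U(Γ)⁻¹`** for any step list (the holonomy of the flipped reversed steps is the inverse). [folklore] -/
theorem holAt_map_flip_reverse {G : Type*} [GaugeGroup G] (U : GaugeField P j G) :
    ∀ Γ : List (LStep P j), holAt U ((Γ.map fun s : LStep P j => (⟨s.bond, !s.fwd⟩ : LStep P j)).reverse) = (holAt U Γ)⁻¹
  | [] => by simp [holAt_nil]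
  | s :: Γ => by
    rw [List.map_cons, List.reverse_cons, holAt_append, holAt_map_flip_reverse U Γ, holAt_cons, holAt_cons, holAt_nil, mul_one, mul_inv_rev]
    cases s.fwd <;> simp

/-! ## §2 The letters of the reversed walk -/

/-- ★★ **THE REVERSAL LAW**: for `t < |Γ|`, the `t`-th letter of the flipped reversed step list is minus the `(|Γ|−(t+1))`-th letter of `Γ` conjugated by `U₀(Γ)⁻¹`:
`Λ_t((Γ.map flip).reverse; covStep) = −(U₀(Γ)^* · Λ_{|Γ|−(t+1)}(Γ; covStep) · U₀(Γ))`. [cite: Balaban1985Averaging, (58) p.27; Balaban1987RG1, (0.4) p.253] -/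
theorem letter_reverse_flip (U₀ : GaugeField P j (Matrix.specialUnitaryGroup n ℂ)) (Y : PBond P j → Matrix n n ℂ) (Γ : List (LStep P j)) {t : ℕ}
    (ht : t < Γ.length) :
    ((holAt U₀ (((Γ.map fun s : LStep P j => (⟨s.bond, !s.fwd⟩ : LStep P j)).reverse).take t) : Matrix.specialUnitaryGroup n ℂ) : Matrix n n ℂ)
        * ((((Γ.map fun s : LStep P j => (⟨s.bond, !s.fwd⟩ : LStep P j)).reverse)[t]?).map (covStep U₀ Y)).getD 0
        * star ((holAt U₀ (((Γ.map fun s : LStep P j => (⟨s.bond, !s.fwd⟩ : LStep P j)).reverse).take t) : Matrix.specialUnitaryGroup n ℂ) : Matrix n n ℂ)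
      = -(star ((holAt U₀ Γ : Matrix.specialUnitaryGroup n ℂ) : Matrix n n ℂ)
          * (((holAt U₀ (Γ.take (Γ.length - (t + 1))) : Matrix.specialUnitaryGroup n ℂ) : Matrix n n ℂ)
              * ((Γ[Γ.length - (t + 1)]?).map (covStep U₀ Y)).getD 0
              * star ((holAt U₀ (Γ.take (Γ.length - (t + 1))) : Matrix.specialUnitaryGroup n ℂ) : Matrix n n ℂ))
          * ((holAt U₀ Γ : Matrix.specialUnitaryGroup n ℂ) : Matrix n n ℂ)) := by
  -- the index of the mirrored step and the step itself
  set k : ℕ := Γ.length - (t + 1) with hk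
  have hkt : k < Γ.length := by omega
  have hlen : (Γ.map fun s : LStep P j => (⟨s.bond, !s.fwd⟩ : LStep P j)).length = Γ.length := List.length_map _
  obtain ⟨s, hs⟩ : ∃ s, Γ[k]? = some s := ⟨Γ[k], (List.getElem?_eq_getElem hkt)⟩
  -- (b) the `t`-th step of the reversed flipped list is the flip of `s`
  have hget : ((Γ.map fun s : LStep P j => (⟨s.bond, !s.fwd⟩ : LStep P j)).reverse)[t]? = some ⟨s.bond, !s.fwd⟩ := by
    rw [List.getElem?_reverse (by rw [hlen]; exact ht), hlen, List.getElem?_map, show Γ.length - 1 - t = k by omega, hs]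
    rfl
  -- (a) the prefix of length `t` of the reversed flipped list is the flipped reverse of `Γ.drop (k+1)`
  have htake : ((Γ.map fun s : LStep P j => (⟨s.bond, !s.fwd⟩ : LStep P j)).reverse).take t
      = ((Γ.drop (k + 1)).map fun s : LStep P j => (⟨s.bond, !s.fwd⟩ : LStep P j)).reverse := by
    rw [List.take_reverse, hlen, List.map_drop, show Γ.length - t = k + 1 by omega]
  -- holonomy bookkeeping: `U₀(Γ) = U₀(Γ.take k) · g_s · U₀(Γ.drop (k+1))`
  have hsplit : holAt U₀ Γ = holAt U₀ (Γ.take k) * (holAt U₀ [s] * holAt U₀ (Γ.drop (k + 1))) := by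
    conv_lhs => rw [← List.take_append_drop k Γ, List.drop_eq_getElem_cons hkt]
    rw [holAt_append, ← List.singleton_append, holAt_append, (List.getElem_eq_iff hkt).mpr hs]
  have hstep : ((holAt U₀ [s] : Matrix.specialUnitaryGroup n ℂ) : Matrix n n ℂ) = stepFactor U₀ s := by
    rw [coe_holAt_eq_prod_stepFactor]; simp
  rw [hget, htake, holAt_map_flip_reverse]
  simp only [Option.map_some, Option.getD_some, hs]
  rw [covStep_flip]
  -- write everything with `A := U₀(Γ.take k)`, `g := g_s`, `B := U₀(Γ.drop (k+1))`
  set A : Matrix n n ℂ := ((holAt U₀ (Γ.take k) : Matrix.specialUnitaryGroup n ℂ) : Matrix n n ℂ) with hA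
  set B : Matrix n n ℂ := ((holAt U₀ (Γ.drop (k + 1)) : Matrix.specialUnitaryGroup n ℂ) : Matrix n n ℂ) with hB
  set g : Matrix n n ℂ := stepFactor U₀ s with hg
  have hinvB : (((holAt U₀ (Γ.drop (k + 1)))⁻¹ : Matrix.specialUnitaryGroup n ℂ) : Matrix n n ℂ) = star B := rfl
  have hΓ : ((holAt U₀ Γ : Matrix.specialUnitaryGroup n ℂ) : Matrix n n ℂ) = A * (g * B) := by
    rw [hsplit, Submonoid.coe_mul, Submonoid.coe_mul, hstep]
  rw [hinvB, star_star, hΓ, star_mul, star_mul]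
  -- `B^* (−(g^* C g)) B = −((A g B)^* (A C A^*) (A g B))` using `A^* A = 1`
  have hAA : star A * A = 1 := coe_star_mul_self _
  set C : Matrix n n ℂ := covStep U₀ Y s with hC
  have e1 : star B * -(star g * C * g) * B = -(star B * star g * (star A * A) * C * (star A * A) * g * B) := by
    rw [hAA]; noncomm_ring
  rw [e1]
  noncomm_ring

/-- ★★ **THE `Fin`-FAMILY FORM** (the input shape of ✓ `Prop7OrderedProductExpansion.commSum_rev_neg`): read on `Fin |Γ|`, the letter family of the flipped reversed list
is `fun i ↦ −(A (Fin.rev i))` with `A i := Ad_{U₀(Γ)⁻¹} Λ_{↑i}(Γ; covStep)`. [cite: Balaban1987RG1, (0.4) p.253] -/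
theorem letter_reverse_flip_eq_rev_neg (U₀ : GaugeField P j (Matrix.specialUnitaryGroup n ℂ)) (Y : PBond P j → Matrix n n ℂ) (Γ : List (LStep P j)) :
    (fun i : Fin Γ.length =>
        ((holAt U₀ (((Γ.map fun s : LStep P j => (⟨s.bond, !s.fwd⟩ : LStep P j)).reverse).take i) : Matrix.specialUnitaryGroup n ℂ) : Matrix n n ℂ)
          * ((((Γ.map fun s : LStep P j => (⟨s.bond, !s.fwd⟩ : LStep P j)).reverse)[(i : ℕ)]?).map (covStep U₀ Y)).getD 0
          * star ((holAt U₀ (((Γ.map fun s : LStep P j => (⟨s.bond, !s.fwd⟩ : LStep P j)).reverse).take i) : Matrix.specialUnitaryGroup n ℂ) :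
              Matrix n n ℂ))
      = fun i : Fin Γ.length =>
        -((fun i' : Fin Γ.length =>
            (((holAt U₀ Γ)⁻¹ : Matrix.specialUnitaryGroup n ℂ) : Matrix n n ℂ)
              * (((holAt U₀ (Γ.take i') : Matrix.specialUnitaryGroup n ℂ) : Matrix n n ℂ) * ((Γ[(i' : ℕ)]?).map (covStep U₀ Y)).getD 0
                  * star ((holAt U₀ (Γ.take i') : Matrix.specialUnitaryGroup n ℂ) : Matrix n n ℂ))
              * star (((holAt U₀ Γ)⁻¹ : Matrix.specialUnitaryGroup n ℂ) : Matrix n n ℂ)) (Fin.rev i)) := by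
  funext i
  have hinv : (((holAt U₀ Γ)⁻¹ : Matrix.specialUnitaryGroup n ℂ) : Matrix n n ℂ) = star ((holAt U₀ Γ : Matrix.specialUnitaryGroup n ℂ) : Matrix n n ℂ) := rfl
  simp only [letter_reverse_flip U₀ Y Γ i.isLt, Fin.val_rev, hinv, star_star]

end Summit.QuantumFields.YangMills.Theorems.Prop7WordLettersRev

end
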